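import Mathlib.Data.Finset.Union
import Mathlib.Data.Finset.SDiff
import Mathlib.Data.Fintype.Basic
import HarnessLib

/-!
# `UV3BranchExpansionCountingAmortizedFamilies` — EXISTENCE AND UNIQUENESS of the hypothesis-specified families `Dist ∕ X ∕ N` of the amortized
# covering inequality (crux `UnitScaleTilt.HistoryTailL`, stmt-QuantumFields-19936 — SUPPLY side, record-independent finite combinatorics)

Cell `ym3-torus` (YM ladder rung R3 = continuum SU(2) Yang–Mills on T³ — a RUNG, NOT d = 4, NOT infinite volume, NOT a mass gap, NOT Clay);
width seat `ym-ust-19936-w2` (gen 17), explicit-unit helper; `--supports stmt-QuantumFields-19936 --as helper`.  THEOREMS ONLY (0 `def`,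
0 `sorry`, default heartbeats, Mathlib + HarnessLib imports only).

WHAT.  ✓`UV3BranchExpansionCountingAmortizedUniform.sum_pow_card_le_exp_of_smallness` (the knit of (C′)) and ✓`UV3BranchExpansionCounting
AmortizedDiscovery.mem_explored_of_tower_of_lt` ((M′)) take the distorted sets `Dist`, the explored sets `X` and the side-slot readers `N` as
HYPOTHESIS-SPECIFIED families (`hDist0 hDistS hXm hXS hN`; the cell's def-free discipline).  So that the assembly (F-TOP) can `obtain` them
once and use the SAME families in the count, in (M′) and in the definition of the mute class, this file proves, for arbitrary levelled data
`R line : (i : ℕ) → β (i+1) → Finset (β i)`, `ctr`: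

* ★★ `exists_dist` — a family `Dist p i` with `Dist p 0 = ∅` and the ghost recursion `g ∈ Dist p (i+1) ↔ g ∈ p i ∨ line i g ⊆ Dist p i ∪ R(p i)`
  (`i : Fin n`) EXISTS (an upward `Nat.rec`, no casts); ★ `dist_unique` — any two such families agree at every level `i ≤ n` (so the relative
  family here and an absolutely-indexed one, e.g. ✓`UV3BranchExpansionDistortedSet`'s, coincide after re-indexing);
* ★★ `exists_explored` — a family `X m A p i` with `X m A p m = A` and, for `i < m`, `X m A p i = (line(X m A p (i+1) ∖ p i) ∪ R(p i)) ∩ Dist p i`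
  EXISTS for any given `Dist` (downward construction level by level, the one cast confined to the proof); ★ `explored_unique`;
* ★ `exists_readers` — `N i G = {c | ∃ g ∈ G, ∃ b ∈ line i g ∖ {ctr i g}, b ∈ R i c}` as a `Finset` family;
* ★★★ `exists_families` — all three at once, in the binder shapes of the knit.

HONEST SCOPE.  [folklore] bookkeeping; nothing model-specific; nothing of hTop, the χ record, (O‴χₛ), `HistoryTailL`, R3 is proved; the
Yang–Mills mass gap is NOT proved.

References: LEAD note `Cruxes/HistoryTailL/HTopBranchExpansion.md` v1.2 §4–§6 (2026-08-30); T. Bałaban, CMP **102** (1985) 255–275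
[Balaban1985UV3].
-/

set_option autoImplicit false

namespace Summit.QuantumFields.YangMills.Theorems.UV3BranchExpansionCountingAmortizedFamilies

variable {β : ℕ → Type*} [∀ i, DecidableEq (β i)] {n : ℕ}
variable (R line : (i : ℕ) → β (i + 1) → Finset (β i)) (ctr : (i : ℕ) → β (i + 1) → β i)

/-! ## §1 Distorted sets -/

/-- ★★ **EXISTENCE OF THE DISTORTED-SET FAMILY** (fired ∪ ghosts, bottom-up). [folklore] -/
theorem exists_dist [∀ i, Fintype (β i)] :
    ∃ Dist : ((i : Fin n) → Finset (β ((i : ℕ) + 1))) → (i : ℕ) → Finset (β i),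
      (∀ p, Dist p 0 = ∅) ∧
      ∀ p (i : Fin n) (g : β ((i : ℕ) + 1)),
        g ∈ Dist p ((i : ℕ) + 1) ↔ g ∈ p i ∨ line i g ⊆ Dist p i ∪ (p i).biUnion (R i) := by
  classical
  refine ⟨fun p i => Nat.rec (motive := fun i => Finset (β i)) ∅
      (fun i D => if h : i < n then
        p ⟨i, h⟩ ∪ Finset.univ.filter (fun g => line i g ⊆ D ∪ (p ⟨i, h⟩).biUnion (R i)) else ∅) i,
    fun p => rfl, ?_⟩
  intro p i g
  show g ∈ (if h : (i : ℕ) < n then _ else _) ↔ _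
  rw [dif_pos i.isLt]
  simp only [Finset.mem_union, Finset.mem_filter, Finset.mem_univ, true_and, Fin.eta]

/-- ★ **UNIQUENESS OF THE DISTORTED SETS**: two families satisfying the recursion agree at every level `i ≤ n`. [folklore] -/
theorem dist_unique
    {Dist Dist' : ((i : Fin n) → Finset (β ((i : ℕ) + 1))) → (i : ℕ) → Finset (β i)}
    (h0 : ∀ p, Dist p 0 = ∅)
    (hS : ∀ p (i : Fin n) (g : β ((i : ℕ) + 1)),
      g ∈ Dist p ((i : ℕ) + 1) ↔ g ∈ p i ∨ line i g ⊆ Dist p i ∪ (p i).biUnion (R i))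
    (h0' : ∀ p, Dist' p 0 = ∅)
    (hS' : ∀ p (i : Fin n) (g : β ((i : ℕ) + 1)),
      g ∈ Dist' p ((i : ℕ) + 1) ↔ g ∈ p i ∨ line i g ⊆ Dist' p i ∪ (p i).biUnion (R i))
    (p : (i : Fin n) → Finset (β ((i : ℕ) + 1))) : ∀ i, i ≤ n → Dist p i = Dist' p i := by
  intro i
  induction i with
  | zero => intro _; rw [h0, h0']
  | succ i ih =>
    intro hi
    have hin : i < n := Nat.lt_of_succ_le hi
    ext g
    rw [hS p ⟨i, hin⟩ g, hS' p ⟨i, hin⟩ g, ih hin.le]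

/-! ## §2 Explored sets -/

omit [∀ i, DecidableEq (β i)] in
/-- One downward chain: for a start set `A` at level `m` and one-step maps `F i : Finset (β (i+1)) → Finset (β i)` there is `f` with `f m = A` and
`f i = F i (f (i+1))` for `i < m`. [folklore] -/
theorem exists_chain (F : (i : ℕ) → Finset (β (i + 1)) → Finset (β i)) :
    ∀ m (A : Finset (β m)), ∃ f : (i : ℕ) → Finset (β i), f m = A ∧ ∀ i, i < m → f i = F i (f (i + 1)) := by
  intro m
  induction m with
  | zero =>
    intro A
    exact ⟨fun i => Nat.rec (motive := fun i => Finset (β i)) A (fun _ _ => ∅) i, rfl, fun i hi => absurd hi (Nat.not_lt_zero i)⟩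
  | succ m ih =>
    intro A
    obtain ⟨f', hf'm, hf'S⟩ := ih (F m A)
    refine ⟨fun i => if h : i = m + 1 then h ▸ A else f' i, by simp, ?_⟩
    intro i hi
    have hne : i ≠ m + 1 := Nat.ne_of_lt hi
    show (if h : i = m + 1 then h ▸ A else f' i) = F i (if h : i + 1 = m + 1 then h ▸ A else f' (i + 1))
    rw [dif_neg hne]
    rcases Nat.lt_succ_iff_lt_or_eq.mp hi with h | h
    · rw [hf'S i h, dif_neg (by omega)]
    · subst h; rw [hf'm, dif_pos rfl]

/-- ★★ **EXISTENCE OF THE EXPLORED-SET FAMILY** for a given distorted-set family. [folklore] -/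
theorem exists_explored (Dist : ((i : Fin n) → Finset (β ((i : ℕ) + 1))) → (i : ℕ) → Finset (β i)) :
    ∃ X : (m : ℕ) → Finset (β m) → ((i : Fin n) → Finset (β ((i : ℕ) + 1))) → (i : ℕ) → Finset (β i),
      (∀ m (A : Finset (β m)) p, X m A p m = A) ∧
      ∀ m (A : Finset (β m)) p (i : Fin n), (i : ℕ) < m →
        X m A p i = ((X m A p ((i : ℕ) + 1) \ p i).biUnion (line i) ∪ (p i).biUnion (R i)) ∩ Dist p i := by
  classical
  -- the one-step map, extended by `∅` above the pattern range
  let F : ((i : Fin n) → Finset (β ((i : ℕ) + 1))) → (i : ℕ) → Finset (β (i + 1)) → Finset (β i) := fun p i Y =>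
    if h : i < n then ((Y \ p ⟨i, h⟩).biUnion (line i) ∪ (p ⟨i, h⟩).biUnion (R i)) ∩ Dist p i else ∅
  have hex := fun (m : ℕ) (A : Finset (β m)) (p : (i : Fin n) → Finset (β ((i : ℕ) + 1))) =>
    exists_chain (F p) m A
  refine ⟨fun m A p => Classical.choose (hex m A p), fun m A p => (Classical.choose_spec (hex m A p)).1, ?_⟩
  intro m A p i him
  show Classical.choose (hex m A p) i =
    ((Classical.choose (hex m A p) ((i : ℕ) + 1) \ p i).biUnion (line i) ∪ (p i).biUnion (R i)) ∩ Dist p i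
  rw [(Classical.choose_spec (hex m A p)).2 i him]
  show (if h : (i : ℕ) < n then _ else _) = _
  rw [dif_pos i.isLt]

/-- ★ **UNIQUENESS OF THE EXPLORED SETS** below the start level. [folklore] -/
theorem explored_unique (Dist : ((i : Fin n) → Finset (β ((i : ℕ) + 1))) → (i : ℕ) → Finset (β i))
    {X X' : (m : ℕ) → Finset (β m) → ((i : Fin n) → Finset (β ((i : ℕ) + 1))) → (i : ℕ) → Finset (β i)}
    (hXm : ∀ m (A : Finset (β m)) p, X m A p m = A)
    (hXS : ∀ m (A : Finset (β m)) p (i : Fin n), (i : ℕ) < m →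
      X m A p i = ((X m A p ((i : ℕ) + 1) \ p i).biUnion (line i) ∪ (p i).biUnion (R i)) ∩ Dist p i)
    (hXm' : ∀ m (A : Finset (β m)) p, X' m A p m = A)
    (hXS' : ∀ m (A : Finset (β m)) p (i : Fin n), (i : ℕ) < m →
      X' m A p i = ((X' m A p ((i : ℕ) + 1) \ p i).biUnion (line i) ∪ (p i).biUnion (R i)) ∩ Dist p i)
    {m : ℕ} (hm : m ≤ n) (A : Finset (β m)) (p : (i : Fin n) → Finset (β ((i : ℕ) + 1))) :
    ∀ i, i ≤ m → X m A p i = X' m A p i := by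
  suffices h : ∀ d i, i + d = m → X m A p i = X' m A p i by
    intro i hi; exact h (m - i) i (by omega)
  intro d
  induction d with
  | zero => intro i hi; rw [Nat.add_zero] at hi; subst hi; rw [hXm, hXm']
  | succ d ih =>
    intro i hi
    have him : i < m := by omega
    have hin : i < n := lt_of_lt_of_le him hm
    have h1 := hXS m A p ⟨i, hin⟩ him
    have h2 := hXS' m A p ⟨i, hin⟩ him
    simp only [Fin.val_mk] at h1 h2
    rw [h1, h2, ih (i + 1) (by omega)]

/-! ## §3 Readers, and the three families at once -/

/-- ★ The side-slot readers as a `Finset` family. [folklore] -/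
theorem exists_readers [∀ i, Fintype (β i)] :
    ∃ N : (i : ℕ) → Finset (β (i + 1)) → Finset (β (i + 1)),
      ∀ i G c, c ∈ N i G ↔ ∃ g ∈ G, ∃ b ∈ (line i g).erase (ctr i g), b ∈ R i c := by
  classical
  exact ⟨fun i G => Finset.univ.filter (fun c => ∃ g ∈ G, ∃ b ∈ (line i g).erase (ctr i g), b ∈ R i c),
    fun i G c => by simp only [Finset.mem_filter, Finset.mem_univ, true_and]⟩

/-- ★★★ **THE THREE HYPOTHESIS-SPECIFIED FAMILIES EXIST**, in the binder shapes of ✓`…CountingAmortizedUniform.sum_pow_card_le_exp_of_smallness`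
(`hDist0 hDistS hXm hXS hN`). [folklore] -/
theorem exists_families [∀ i, Fintype (β i)] :
    ∃ (Dist : ((i : Fin n) → Finset (β ((i : ℕ) + 1))) → (i : ℕ) → Finset (β i))
      (X : (m : ℕ) → Finset (β m) → ((i : Fin n) → Finset (β ((i : ℕ) + 1))) → (i : ℕ) → Finset (β i))
      (N : (i : ℕ) → Finset (β (i + 1)) → Finset (β (i + 1))),
      (∀ p, Dist p 0 = ∅) ∧
      (∀ p (i : Fin n) (g : β ((i : ℕ) + 1)),
        g ∈ Dist p ((i : ℕ) + 1) ↔ g ∈ p i ∨ line i g ⊆ Dist p i ∪ (p i).biUnion (R i)) ∧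
      (∀ m (A : Finset (β m)) p, X m A p m = A) ∧
      (∀ m (A : Finset (β m)) p (i : Fin n), (i : ℕ) < m →
        X m A p i = ((X m A p ((i : ℕ) + 1) \ p i).biUnion (line i) ∪ (p i).biUnion (R i)) ∩ Dist p i) ∧
      (∀ i G c, c ∈ N i G ↔ ∃ g ∈ G, ∃ b ∈ (line i g).erase (ctr i g), b ∈ R i c) := by
  obtain ⟨Dist, hD0, hDS⟩ := exists_dist (n := n) R line
  obtain ⟨X, hXm, hXS⟩ := exists_explored (n := n) R line Dist
  obtain ⟨N, hN⟩ := exists_readers R line ctr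
  exact ⟨Dist, X, N, hD0, hDS, hXm, hXS, hN⟩

end Summit.QuantumFields.YangMills.Theorems.UV3BranchExpansionCountingAmortizedFamilies
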